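import Summits.AnomalousDissipation.AnomalousDissipation.Theorems.SawtoothPulseCascadeK1LocalisedCascadeBlockJunkOscGeom

/-!
# K1loc — helper: THE JUNK OF A FAMILY OF GEOMETRIC FIBRE BLOCKS, CORNER-TRACE GRADE (closed form)

Helper file of the prover lane on the crux `K1LocalisedCascade` (stmt-AnomalousDissipation-19491), route `SawtoothPulseCascade`
(S-D seat, arbiter A24-4: the phase-3 CT ledger; arithmetic layer, CT grade; companion of `…BlockJunkOsc`).  The corner-trace
multi-block class steps (`…RatioBlocksCT`, `…StripBlocksCT`) charge, on block `m` (fibres `Λ_m ≤ |k_i| < Λ_{m+1}`, gap `D_m`, source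
lobe `Q_m = L_m + R_m`, trace ratio `T_m = (2L_m+R_m)/R_m`, rounding scale `Λ'_m = Λ_{m+1}G`), the junk amplitude `√J_CT,m + √J_round,m`,
  `J_CT,m = 3Nσ_m/π²·(2N·T_m) + 12N²Q_m²(2Q_m/N + 1)σ_m/(π²D_m²)`, `σ_m = 1/(D_m+Q_m)² + 1/(N(D_m+Q_m))`,
  `J_round,m = (πΛ'_mε/N)² + 8Mδ·T_m/π`.
On CANONICAL (geometric) blocks — gap floor `D_m ≥ D₀2^m`, fibre span `D_m + Q_m ≥ S₀2^m`, lobe `0 ≤ Q_m ≤ q₀2^m`, trace ratio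
`0 ≤ T_m ≤ r*`, `0 ≤ Λ'_m ≤ ℓ₀2^{m+1}` — the junk ENERGY of `M_b` blocks is at most **`(√J₁ + √J₂)²`** (`blockJunk_ct_sum_le`) with
  `J₁ = (6N²r*(4/(3S₀²) + 2/(NS₀)) + 12N²(q₀/D₀)²(4q₀/(NS₀²) + 4/(3S₀²) + 2/(NS₀) + M_b·2q₀/(N²S₀)))/π²`,
  `J₂ = (4/3)(πℓ₀ε2^{M_b}/N)² + M_b·(8Mδ·r*/π)`:
the kernel weight `σ_m` is geometric over the blocks (`ctSigma_le`), the lobe/gap ratio is block-independent (`Q_m/D_m ≤ q₀/D₀`),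
the residue-count part `2Q_m/N·1/(N(D_m+Q_m))` is scale free and grows linearly with the number of blocks, and the two amplitudes
are combined ACROSS the blocks by Minkowski (`sum_sq_sqrt_add_sqrt_le`), so no factor `2` is lost between the CT and the rounding junk.
Pure real arithmetic; no definitions; no statement about the crux. [cite: Grafakos2014, Prop. 3.2.7 (3)] [problem: turb]
-/

-- `Summit.<Summit>.<Problem>`: single-conjunct summit, the duplicate namespace segment is deliberate.
set_option linter.dupNamespace false

noncomputable section

namespace Summit.AnomalousDissipation.AnomalousDissipation.Theorems.SawtoothPulseCascade.K1Window

open Finset Real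
open Summit.AnomalousDissipation.AnomalousDissipation.Theorems.SawtoothPulseCascade.K1Ledger.From

/-! ## §1 Two elementary sums -/

/-- **Minkowski across blocks**: for `a_i, b_i ≥ 0`, `Σ_i (√a_i + √b_i)² ≤ (√(Σ_i a_i) + √(Σ_i b_i))²` (Cauchy–Schwarz on the
cross term). [folklore] -/
theorem sum_sq_sqrt_add_sqrt_le {ι : Type*} (s : Finset ι) {a b : ι → ℝ} (ha : ∀ i, 0 ≤ a i) (hb : ∀ i, 0 ≤ b i) :
    ∑ i ∈ s, (Real.sqrt (a i) + Real.sqrt (b i)) ^ 2 ≤ (Real.sqrt (∑ i ∈ s, a i) + Real.sqrt (∑ i ∈ s, b i)) ^ 2 := by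
  have hA : 0 ≤ ∑ i ∈ s, a i := sum_nonneg fun i _ => ha i
  have hB : 0 ≤ ∑ i ∈ s, b i := sum_nonneg fun i _ => hb i
  have e : ∀ i, (Real.sqrt (a i) + Real.sqrt (b i)) ^ 2 = a i + b i + 2 * (Real.sqrt (a i) * Real.sqrt (b i)) :=
    fun i => by rw [add_sq, Real.sq_sqrt (ha i), Real.sq_sqrt (hb i)]; ring
  simp_rw [e]
  rw [sum_add_distrib, sum_add_distrib, ← mul_sum, add_sq, Real.sq_sqrt hA, Real.sq_sqrt hB]
  have hcs := Real.sum_sqrt_mul_sqrt_le s ha hb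
  linarith

/-- `Σ_{m<M} (1/4)^m ≤ 4/3`. [folklore] -/
theorem sum_range_quarter_pow_le (M : ℕ) : ∑ m ∈ range M, (1 / 4 : ℝ) ^ m ≤ 4 / 3 := by
  have h := sum_range_inv_pow_le_of_lt (ρ := (4 : ℝ)) (by norm_num) M
  norm_num at h ⊢
  exact h

/-! ## §2 One block -/

/-- **The CT kernel weight on a geometric block**: `0 < S₀2^m ≤ D + Q` and `N > 0` give
`1/(D+Q)² + 1/(N(D+Q)) ≤ (1/S₀²)((1/2)^m)² + (1/(NS₀))(1/2)^m`. [folklore] -/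
theorem ctSigma_le {D Q N S₀ : ℝ} {m : ℕ} (hN : 0 < N) (hS₀ : 0 < S₀) (hS : S₀ * 2 ^ m ≤ D + Q) :
    1 / (D + Q) ^ 2 + 1 / (N * (D + Q)) ≤ 1 / S₀ ^ 2 * ((1 / 2 : ℝ) ^ m) ^ 2 + 1 / (N * S₀) * (1 / 2 : ℝ) ^ m := by
  have hS2 : 0 < S₀ * 2 ^ m := by positivity
  have hN0 : N ≠ 0 := hN.ne'
  have hS0 : S₀ ≠ 0 := hS₀.ne'
  have h2 : (2 : ℝ) ^ m ≠ 0 := pow_ne_zero _ two_ne_zero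
  have e1 : 1 / (S₀ * 2 ^ m) ^ 2 = 1 / S₀ ^ 2 * ((1 / 2 : ℝ) ^ m) ^ 2 := by
    field_simp
    rw [← mul_pow, ← mul_pow]; norm_num
  have e2 : 1 / (N * (S₀ * 2 ^ m)) = 1 / (N * S₀) * (1 / 2 : ℝ) ^ m := by
    field_simp
    rw [← mul_pow]; norm_num
  rw [← e1, ← e2]
  exact add_le_add (one_div_le_one_div_of_le (pow_pos hS2 2) (pow_le_pow_left₀ hS2.le hS 2))
    (one_div_le_one_div_of_le (by positivity) (mul_le_mul_of_nonneg_left hS hN.le))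

/-- **One block's CT junk energy on a geometric block**: gap `D ≥ D₀2^m`, span `D + Q ≥ S₀2^m`, lobe `0 ≤ Q ≤ q₀2^m`, trace ratio
`0 ≤ T ≤ r*` give `J_CT ≤ (6N²r*·s_m + 12N²(q₀/D₀)²((2q₀/(NS₀²))(1/2)^m + 2q₀/(N²S₀) + s_m))/π²`,
`s_m = (1/S₀²)((1/2)^m)² + (1/(NS₀))(1/2)^m`. [folklore] -/
theorem ctJunk_block_le {D Q T N D₀ S₀ q₀ rs : ℝ} {m : ℕ} (hN : 0 < N) (hD₀ : 0 < D₀) (hS₀ : 0 < S₀) (hq₀ : 0 ≤ q₀)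
    (hD : D₀ * 2 ^ m ≤ D) (hS : S₀ * 2 ^ m ≤ D + Q) (hQ0 : 0 ≤ Q) (hQ : Q ≤ q₀ * 2 ^ m) (hT0 : 0 ≤ T) (hT : T ≤ rs) :
    3 * N * (1 / (D + Q) ^ 2 + 1 / (N * (D + Q))) / π ^ 2 * (2 * N * T) +
        12 * N ^ 2 * Q ^ 2 * (2 * Q / N + 1) * (1 / (D + Q) ^ 2 + 1 / (N * (D + Q))) / (π ^ 2 * D ^ 2) * 1 ≤
      (6 * N ^ 2 * rs * (1 / S₀ ^ 2 * ((1 / 2 : ℝ) ^ m) ^ 2 + 1 / (N * S₀) * (1 / 2 : ℝ) ^ m) +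
        12 * N ^ 2 * (q₀ / D₀) ^ 2 * (2 * q₀ / (N * S₀ ^ 2) * (1 / 2 : ℝ) ^ m + 2 * q₀ / (N ^ 2 * S₀) +
          (1 / S₀ ^ 2 * ((1 / 2 : ℝ) ^ m) ^ 2 + 1 / (N * S₀) * (1 / 2 : ℝ) ^ m))) / π ^ 2 := by
  have hπ := Real.pi_pos
  have hN0 : N ≠ 0 := hN.ne'
  have hS0 : S₀ ≠ 0 := hS₀.ne'
  have hD00 : D₀ ≠ 0 := hD₀.ne'
  have hπ0 : (π : ℝ) ≠ 0 := hπ.ne'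
  set σ : ℝ := 1 / (D + Q) ^ 2 + 1 / (N * (D + Q)) with hσ
  set s : ℝ := 1 / S₀ ^ 2 * ((1 / 2 : ℝ) ^ m) ^ 2 + 1 / (N * S₀) * (1 / 2 : ℝ) ^ m with hs
  have hσs : σ ≤ s := ctSigma_le hN hS₀ hS
  have hDQ : 0 < D + Q := lt_of_lt_of_le (by positivity) hS
  have hσ0 : 0 ≤ σ := by positivity
  have hs0 : 0 ≤ s := hσ0.trans hσs
  have hDpos : 0 < D := lt_of_lt_of_le (by positivity) hD
  have hD0' : D ≠ 0 := hDpos.ne'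
  -- the lobe/gap ratio
  have hQD : Q ≤ q₀ / D₀ * D := by
    calc Q ≤ q₀ * 2 ^ m := hQ
      _ = q₀ / D₀ * (D₀ * 2 ^ m) := by field_simp
      _ ≤ q₀ / D₀ * D := mul_le_mul_of_nonneg_left hD (by positivity)
  have hQ2 : Q ^ 2 ≤ (q₀ / D₀) ^ 2 * D ^ 2 := by
    rw [← mul_pow]; exact pow_le_pow_left₀ hQ0 hQD 2
  have hQD2 : Q ^ 2 / D ^ 2 ≤ (q₀ / D₀) ^ 2 := by
    rw [div_le_iff₀ (by positivity)]; exact hQ2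
  -- the trace term
  have h1 : 3 * N * σ / π ^ 2 * (2 * N * T) ≤ 6 * N ^ 2 * rs * s / π ^ 2 := by
    have : σ * T ≤ s * rs := mul_le_mul hσs hT hT0 hs0
    have e1 : 3 * N * σ / π ^ 2 * (2 * N * T) = 6 * N ^ 2 / π ^ 2 * (σ * T) := by ring
    have e2 : 6 * N ^ 2 * rs * s / π ^ 2 = 6 * N ^ 2 / π ^ 2 * (s * rs) := by ring
    rw [e1, e2]; exact mul_le_mul_of_nonneg_left this (by positivity)
  -- the residue-count term
  have h2m : (2 : ℝ) ^ m * ((1 / 2 : ℝ) ^ m) ^ 2 = (1 / 2 : ℝ) ^ m := by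
    rw [sq, ← mul_assoc, ← mul_pow]; norm_num
  have h2m' : (2 : ℝ) ^ m * (1 / 2 : ℝ) ^ m = 1 := by rw [← mul_pow]; norm_num
  have hfac : (2 * Q / N + 1) * σ ≤ 2 * q₀ / (N * S₀ ^ 2) * (1 / 2 : ℝ) ^ m + 2 * q₀ / (N ^ 2 * S₀) + s := by
    have hα : 2 * Q / N + 1 ≤ 2 * (q₀ * 2 ^ m) / N + 1 := by
      have := div_le_div_of_nonneg_right (mul_le_mul_of_nonneg_left hQ zero_le_two) hN.le
      linarith
    calc (2 * Q / N + 1) * σ ≤ (2 * (q₀ * 2 ^ m) / N + 1) * s := mul_le_mul hα hσs hσ0 (by positivity)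
      _ = 2 * q₀ / (N * S₀ ^ 2) * ((2 : ℝ) ^ m * ((1 / 2 : ℝ) ^ m) ^ 2) +
            2 * q₀ / (N ^ 2 * S₀) * ((2 : ℝ) ^ m * (1 / 2 : ℝ) ^ m) + s := by
          rw [hs]; ring
      _ = 2 * q₀ / (N * S₀ ^ 2) * (1 / 2 : ℝ) ^ m + 2 * q₀ / (N ^ 2 * S₀) + s := by rw [h2m, h2m', mul_one]
  have h2 : 12 * N ^ 2 * Q ^ 2 * (2 * Q / N + 1) * σ / (π ^ 2 * D ^ 2) * 1 ≤
      12 * N ^ 2 * (q₀ / D₀) ^ 2 * (2 * q₀ / (N * S₀ ^ 2) * (1 / 2 : ℝ) ^ m + 2 * q₀ / (N ^ 2 * S₀) + s) / π ^ 2 := by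
    have hβ0 : 0 ≤ (2 * Q / N + 1) * σ := mul_nonneg (by positivity) hσ0
    calc 12 * N ^ 2 * Q ^ 2 * (2 * Q / N + 1) * σ / (π ^ 2 * D ^ 2) * 1
        = 12 * N ^ 2 / π ^ 2 * (Q ^ 2 / D ^ 2) * ((2 * Q / N + 1) * σ) := by
          field_simp
      _ ≤ 12 * N ^ 2 / π ^ 2 * (q₀ / D₀) ^ 2 * (2 * q₀ / (N * S₀ ^ 2) * (1 / 2 : ℝ) ^ m + 2 * q₀ / (N ^ 2 * S₀) + s) :=
          mul_le_mul (mul_le_mul_of_nonneg_left hQD2 (by positivity)) hfac hβ0 (by positivity)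
      _ = _ := by ring
  calc _ ≤ 6 * N ^ 2 * rs * s / π ^ 2 + 12 * N ^ 2 * (q₀ / D₀) ^ 2 *
        (2 * q₀ / (N * S₀ ^ 2) * (1 / 2 : ℝ) ^ m + 2 * q₀ / (N ^ 2 * S₀) + s) / π ^ 2 := add_le_add h1 h2
    _ = _ := by rw [hs]; ring

/-- **One block's rounding junk energy on a geometric block**: `0 ≤ Λ' ≤ ℓ₀2^{m+1}`, `0 ≤ T ≤ r*`, `ε, M, δ ≥ 0` give
`(πΛ'ε/N)² + 8Mδ·T/π ≤ (πℓ₀ε/N)²(2^{m+1})² + 8Mδ·r*/π`. [folklore] -/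
theorem roundJunk_block_le {T Λ' N ℓ₀ ε M δ rs : ℝ} {m : ℕ} (hN : 0 < N) (hε : 0 ≤ ε) (hM : 0 ≤ M) (hδ : 0 ≤ δ)
    (hT : T ≤ rs) (hΛ0 : 0 ≤ Λ') (hΛ : Λ' ≤ ℓ₀ * 2 ^ (m + 1)) :
    (π * Λ' * ε / N) ^ 2 * 1 + 8 * M * δ / π * T ≤
      (π * ℓ₀ * ε / N) ^ 2 * ((2 : ℝ) ^ (m + 1)) ^ 2 + 8 * M * δ / π * rs := by
  have hπ := Real.pi_pos
  have h1 : π * Λ' * ε / N ≤ π * (ℓ₀ * 2 ^ (m + 1)) * ε / N :=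
    div_le_div_of_nonneg_right (mul_le_mul_of_nonneg_right (mul_le_mul_of_nonneg_left hΛ hπ.le) hε) hN.le
  have h0 : 0 ≤ π * Λ' * ε / N := by positivity
  have h2 : (π * Λ' * ε / N) ^ 2 ≤ (π * (ℓ₀ * 2 ^ (m + 1)) * ε / N) ^ 2 := pow_le_pow_left₀ h0 h1 2
  have e : (π * (ℓ₀ * 2 ^ (m + 1)) * ε / N) ^ 2 = (π * ℓ₀ * ε / N) ^ 2 * ((2 : ℝ) ^ (m + 1)) ^ 2 := by ring
  have h3 : 8 * M * δ / π * T ≤ 8 * M * δ / π * rs := mul_le_mul_of_nonneg_left hT (by positivity)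
  rw [mul_one]
  linarith [h2.trans_eq e]

/-! ## §3 The family of blocks -/

/-- **THE CT JUNK OF A FAMILY OF GEOMETRIC BLOCKS** (see the file header): `Σ_{m<M_b} (√J_CT,m + √J_round,m)² ≤ (√J₁ + √J₂)²`.
[cite: Grafakos2014, Prop. 3.2.7 (3)] -/
theorem blockJunk_ct_sum_le {D Q T Λ' : ℕ → ℝ} {N D₀ S₀ q₀ rs ℓ₀ ε M δ : ℝ} (hN : 0 < N) (hD₀ : 0 < D₀) (hS₀ : 0 < S₀)
    (hq₀ : 0 ≤ q₀) (hε : 0 ≤ ε) (hM : 0 ≤ M) (hδ : 0 ≤ δ)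
    (hD : ∀ m, D₀ * 2 ^ m ≤ D m) (hS : ∀ m, S₀ * 2 ^ m ≤ D m + Q m) (hQ0 : ∀ m, 0 ≤ Q m)
    (hQ : ∀ m, Q m ≤ q₀ * 2 ^ m) (hT0 : ∀ m, 0 ≤ T m) (hT : ∀ m, T m ≤ rs) (hΛ0 : ∀ m, 0 ≤ Λ' m)
    (hΛ : ∀ m, Λ' m ≤ ℓ₀ * 2 ^ (m + 1)) (Mb : ℕ) :
    ∑ m ∈ range Mb, (Real.sqrt (3 * N * (1 / (D m + Q m) ^ 2 + 1 / (N * (D m + Q m))) / π ^ 2 * (2 * N * T m) +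
        12 * N ^ 2 * Q m ^ 2 * (2 * Q m / N + 1) * (1 / (D m + Q m) ^ 2 + 1 / (N * (D m + Q m))) /
          (π ^ 2 * D m ^ 2) * 1) +
      Real.sqrt ((π * Λ' m * ε / N) ^ 2 * 1 + 8 * M * δ / π * T m)) ^ 2 ≤
    (Real.sqrt ((6 * N ^ 2 * rs * (4 / (3 * S₀ ^ 2) + 2 / (N * S₀)) +
          12 * N ^ 2 * (q₀ / D₀) ^ 2 * (4 * q₀ / (N * S₀ ^ 2) + 4 / (3 * S₀ ^ 2) + 2 / (N * S₀) +
            Mb * (2 * q₀ / (N ^ 2 * S₀)))) / π ^ 2) +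
      Real.sqrt (4 / 3 * (π * ℓ₀ * ε * 2 ^ Mb / N) ^ 2 + Mb * (8 * M * δ / π * rs))) ^ 2 := by
  have hπ := Real.pi_pos
  have hrs : 0 ≤ rs := (hT0 0).trans (hT 0)
  -- the per-block majorants
  set A : ℕ → ℝ := fun m => (6 * N ^ 2 * rs * (1 / S₀ ^ 2 * ((1 / 2 : ℝ) ^ m) ^ 2 + 1 / (N * S₀) * (1 / 2 : ℝ) ^ m) +
      12 * N ^ 2 * (q₀ / D₀) ^ 2 * (2 * q₀ / (N * S₀ ^ 2) * (1 / 2 : ℝ) ^ m + 2 * q₀ / (N ^ 2 * S₀) +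
        (1 / S₀ ^ 2 * ((1 / 2 : ℝ) ^ m) ^ 2 + 1 / (N * S₀) * (1 / 2 : ℝ) ^ m))) / π ^ 2 with hA
  set B : ℕ → ℝ := fun m => (π * ℓ₀ * ε / N) ^ 2 * ((2 : ℝ) ^ (m + 1)) ^ 2 + 8 * M * δ / π * rs with hB
  have hA0 : ∀ m, 0 ≤ A m := fun m => by simp only [hA]; positivity
  have hB0 : ∀ m, 0 ≤ B m := fun m => by simp only [hB]; positivity
  -- block by block
  have hsum1 : ∑ m ∈ range Mb, (Real.sqrt (3 * N * (1 / (D m + Q m) ^ 2 + 1 / (N * (D m + Q m))) / π ^ 2 * (2 * N * T m) +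
        12 * N ^ 2 * Q m ^ 2 * (2 * Q m / N + 1) * (1 / (D m + Q m) ^ 2 + 1 / (N * (D m + Q m))) /
          (π ^ 2 * D m ^ 2) * 1) +
      Real.sqrt ((π * Λ' m * ε / N) ^ 2 * 1 + 8 * M * δ / π * T m)) ^ 2 ≤
      ∑ m ∈ range Mb, (Real.sqrt (A m) + Real.sqrt (B m)) ^ 2 := by
    refine Finset.sum_le_sum fun m _ => ?_
    refine pow_le_pow_left₀ (add_nonneg (Real.sqrt_nonneg _) (Real.sqrt_nonneg _))
      (add_le_add (Real.sqrt_le_sqrt ?_) (Real.sqrt_le_sqrt ?_)) 2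
    · exact ctJunk_block_le hN hD₀ hS₀ hq₀ (hD m) (hS m) (hQ0 m) (hQ m) (hT0 m) (hT m)
    · exact roundJunk_block_le hN hε hM hδ (hT m) (hΛ0 m) (hΛ m)
  have hsum2 := sum_sq_sqrt_add_sqrt_le (range Mb) hA0 hB0
  -- the two geometric sums
  have hX : ∑ m ∈ range Mb, ((1 / 2 : ℝ) ^ m) ^ 2 ≤ 4 / 3 := by
    have e : ∀ m : ℕ, ((1 / 2 : ℝ) ^ m) ^ 2 = (1 / 4 : ℝ) ^ m := fun m => by
      rw [← pow_mul, mul_comm, pow_mul]; norm_num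
    simp_rw [e]; exact sum_range_quarter_pow_le Mb
  have hY : ∑ m ∈ range Mb, (1 / 2 : ℝ) ^ m ≤ 2 := sum_range_half_pow_le Mb
  have hZ : ∑ m ∈ range Mb, ((2 : ℝ) ^ (m + 1)) ^ 2 ≤ 4 / 3 * ((2 : ℝ) ^ Mb) ^ 2 := sum_range_sq_two_pow_succ_le Mb
  have hX0 : 0 ≤ ∑ m ∈ range Mb, ((1 / 2 : ℝ) ^ m) ^ 2 := sum_nonneg fun m _ => by positivity
  have hY0 : 0 ≤ ∑ m ∈ range Mb, (1 / 2 : ℝ) ^ m := sum_nonneg fun m _ => by positivity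
  -- the sum of the CT majorants
  set c₁ : ℝ := (6 * N ^ 2 * rs * (1 / S₀ ^ 2) + 12 * N ^ 2 * (q₀ / D₀) ^ 2 * (1 / S₀ ^ 2)) / π ^ 2 with hc₁
  set c₂ : ℝ := (6 * N ^ 2 * rs * (1 / (N * S₀)) +
      12 * N ^ 2 * (q₀ / D₀) ^ 2 * (2 * q₀ / (N * S₀ ^ 2) + 1 / (N * S₀))) / π ^ 2 with hc₂
  set c₃ : ℝ := 12 * N ^ 2 * (q₀ / D₀) ^ 2 * (2 * q₀ / (N ^ 2 * S₀)) / π ^ 2 with hc₃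
  have hc₁0 : 0 ≤ c₁ := by positivity
  have hc₂0 : 0 ≤ c₂ := by positivity
  have eA : ∀ m, A m = c₁ * ((1 / 2 : ℝ) ^ m) ^ 2 + c₂ * (1 / 2 : ℝ) ^ m + c₃ := fun m => by
    simp only [hA, hc₁, hc₂, hc₃]; ring
  have hSA : ∑ m ∈ range Mb, A m ≤ (6 * N ^ 2 * rs * (4 / (3 * S₀ ^ 2) + 2 / (N * S₀)) +
      12 * N ^ 2 * (q₀ / D₀) ^ 2 * (4 * q₀ / (N * S₀ ^ 2) + 4 / (3 * S₀ ^ 2) + 2 / (N * S₀) +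
        Mb * (2 * q₀ / (N ^ 2 * S₀)))) / π ^ 2 := by
    have e : ∑ m ∈ range Mb, A m = c₁ * ∑ m ∈ range Mb, ((1 / 2 : ℝ) ^ m) ^ 2 +
        c₂ * ∑ m ∈ range Mb, (1 / 2 : ℝ) ^ m + Mb * c₃ := by
      simp_rw [eA]
      rw [sum_add_distrib, sum_add_distrib, ← mul_sum, ← mul_sum, sum_const, card_range, nsmul_eq_mul]
    rw [e]
    have h1 : c₁ * ∑ m ∈ range Mb, ((1 / 2 : ℝ) ^ m) ^ 2 ≤ c₁ * (4 / 3) := mul_le_mul_of_nonneg_left hX hc₁0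
    have h2 : c₂ * ∑ m ∈ range Mb, (1 / 2 : ℝ) ^ m ≤ c₂ * 2 := mul_le_mul_of_nonneg_left hY hc₂0
    have e2 : c₁ * (4 / 3) + c₂ * 2 + Mb * c₃ = (6 * N ^ 2 * rs * (4 / (3 * S₀ ^ 2) + 2 / (N * S₀)) +
        12 * N ^ 2 * (q₀ / D₀) ^ 2 * (4 * q₀ / (N * S₀ ^ 2) + 4 / (3 * S₀ ^ 2) + 2 / (N * S₀) +
          Mb * (2 * q₀ / (N ^ 2 * S₀)))) / π ^ 2 := by
      simp only [hc₁, hc₂, hc₃]; ring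
    linarith
  -- the sum of the rounding majorants
  have hSB : ∑ m ∈ range Mb, B m ≤ 4 / 3 * (π * ℓ₀ * ε * 2 ^ Mb / N) ^ 2 + Mb * (8 * M * δ / π * rs) := by
    have e : ∑ m ∈ range Mb, B m = (π * ℓ₀ * ε / N) ^ 2 * ∑ m ∈ range Mb, ((2 : ℝ) ^ (m + 1)) ^ 2 +
        Mb * (8 * M * δ / π * rs) := by
      simp only [hB]
      rw [sum_add_distrib, ← mul_sum, sum_const, card_range, nsmul_eq_mul]
    rw [e]
    have h1 : (π * ℓ₀ * ε / N) ^ 2 * ∑ m ∈ range Mb, ((2 : ℝ) ^ (m + 1)) ^ 2 ≤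
        (π * ℓ₀ * ε / N) ^ 2 * (4 / 3 * ((2 : ℝ) ^ Mb) ^ 2) := mul_le_mul_of_nonneg_left hZ (sq_nonneg _)
    have e2 : (π * ℓ₀ * ε / N) ^ 2 * (4 / 3 * ((2 : ℝ) ^ Mb) ^ 2) = 4 / 3 * (π * ℓ₀ * ε * 2 ^ Mb / N) ^ 2 := by ring
    linarith
  -- assemble
  have hSA0 : 0 ≤ ∑ m ∈ range Mb, A m := sum_nonneg fun m _ => hA0 m
  have hSB0 : 0 ≤ ∑ m ∈ range Mb, B m := sum_nonneg fun m _ => hB0 m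
  refine hsum1.trans (hsum2.trans ?_)
  exact pow_le_pow_left₀ (add_nonneg (Real.sqrt_nonneg _) (Real.sqrt_nonneg _))
    (add_le_add (Real.sqrt_le_sqrt hSA) (Real.sqrt_le_sqrt hSB)) 2

end Summit.AnomalousDissipation.AnomalousDissipation.Theorems.SawtoothPulseCascade.K1Window
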